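import Summits.AtomisticToContinuum.Crystallization.Theses.NashClassCertificates

/-!
# Crux `NashTwoShellGap` (stmt-AtomisticToContinuum-16826), line `birth`: Nash ⇒ hole saturation
# (the Aufbau level)

Nash-class API for the certificate tier of `stub_jammedBadGap` / `stub_exposedBadGap`: in a Nash
Lennard-Jones configuration NO FREE POINT IS DEEPER THAN THE WORST-BOUND PARTICLE, up to one bond:
for every point `y` distinct from all particles and every `i`,

  `siteEnergy x i ≤ ∑_j V_LJ(|y − x_j|) + 1/12`.

(Test the Nash inequality of `i` at `y` and add back the self term `V_LJ(|y − x_i|) ≥ −1/12`.)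
Consequence (informal): vacancies, divacancies and small voids with a well-coordinated pocket —
holes of depth `≈ 2e* ≈ −1.43` — do not occur in Nash clusters, whose worst-bound particle has
`siteEnergy ≳ −0.6`; internal SURFACES (shallow holes) are not excluded.  The statement is the
`AufbauLevel` of `Cruxes/NashTwoShellGap/IdeatorTwoSketch.lean`, in the crux's inlined vocabulary.
No definitions; `[folklore]`.
-/

noncomputable section

namespace Summit.AtomisticToContinuum.Crystallization.Theorems.NashTwoShellGapAufbau

open scoped BigOperators Classical
open Literature.MathematicalPhysics.StatisticalMechanics

/-- **Registered sub-goal `stub_nashAufbau`** (lead, line `birth`): the Aufbau level of a Nash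
configuration — every site energy is at most the potential of any free point plus `1/12`.
(The separation hypothesis of the common prefix is not needed and not used.) [folklore] -/
theorem stub_nashAufbau : ∀ (N : ℕ) (x : Fin N → EuclideanSpace ℝ (Fin 3)), (∀ i j : Fin N, i ≠ j → 1 / 3 ≤ dist (x i) (x j)) → (∀ (i : Fin N) (y : EuclideanSpace ℝ (Fin 3)), (∀ j : Fin N, j ≠ i → y ≠ x j) → Literature.MathematicalPhysics.StatisticalMechanics.siteEnergy Literature.MathematicalPhysics.StatisticalMechanics.lennardJones x i ≤ ∑ j ∈ Finset.univ.erase i, Literature.MathematicalPhysics.StatisticalMechanics.lennardJones (dist y (x j))) → ∀ y : EuclideanSpace ℝ (Fin 3), (∀ j : Fin N, y ≠ x j) → ∀ i : Fin N, Literature.MathematicalPhysics.StatisticalMechanics.siteEnergy Literature.MathematicalPhysics.StatisticalMechanics.lennardJones x i ≤ (∑ j : Fin N, Literature.MathematicalPhysics.StatisticalMechanics.lennardJones (dist y (x j))) + 1 / 12 := by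
  intro N x _ hnash y hy i
  have h1 := hnash i y fun j _ => hy j
  have hsplit : ∑ j : Fin N, lennardJones (dist y (x j))
      = lennardJones (dist y (x i)) + ∑ j ∈ Finset.univ.erase i, lennardJones (dist y (x j)) := by
    rw [← Finset.add_sum_erase _ _ (Finset.mem_univ i)]
  have hV : -1 / 12 ≤ lennardJones (dist y (x i)) := neg_one_div_le_lennardJones _
  rw [hsplit]
  linarith

end Summit.AtomisticToContinuum.Crystallization.Theorems.NashTwoShellGapAufbau

end
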